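import Summits.Langlands.Langlands.Theses.FrobeniusMomentIrreducibility
import Summits.Langlands.Langlands.Theorems.IrreducibilityBySelfDualityReciprocityUpToIrreducibilityGeometricConstituents
import Summits.Langlands.Langlands.Theorems.IrreducibilityBySelfDualityReciprocityUpToIrreducibilityDeRhamBlocks
import Literature.NumberTheory.GaloisRepresentations.GaloisRepFrobeniusProofs
import HarnessLib

/-!
# Route `FrobeniusMomentIrreducibility`, item `IrreducibleOfMoments` (stmt-Langlands-19275) — part 2/3:
# the Galois side (dévissage of a reducible `ρ`, Frobenius polynomials of the blocks, the dictionary)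

(1) If `ρ : Γ_K →ₜ* GL_n(ℚ̄_ℓ)` (`n ≥ 1`) is NOT irreducible, the tree's continuous dévissage with the
change of frame recorded (`exists_conj_continuous_blocks_of_subrepresentation`) gives `P ρ P⁻¹` block
upper triangular with continuous diagonal blocks `ρ₁ = A`, `ρ₂ = D` of positive ranks; these are
unramified wherever `ρ` is (`isUnramifiedAt_blocks`), de Rham at `v ∣ ℓ` for Fontaine's pinned datum
(`isDeRhamFramed_blocks` + the PROVED `stub_deRhamBlocks`), and at every unramified place the Frobenius
characteristic polynomial factors, `P_{v,ρ} = P_{v,A} P_{v,D}` (`exists_blocks_of_not_irreducible`);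
hence `tr ρ(Frob_v) = tr A(Frob_v) + tr D(Frob_v)` and the roots of `P_{v,A}`, `P_{v,D}` are roots of
`P_{v,ρ}` (purity is inherited).
(2) The dictionary at a good place: if `ρ(Frob_v)` has characteristic polynomial
`∏_{a ∈ α'} (X - a⁻¹)` (`SatakeFrobCompatibleAt`, `q_v^{(1-n)/2}`-normalisation with `n = 1`) where
`α' = q_v^{s} α_P(v)`, `|∏ α_P(v)| = 1`, `card α_P(v) = n ≥ 1`, and `ρ` is pure of weight `w` at `v`,
then every element of `α_P(v)` has absolute value `1`, `|q_v^{s}| = q_v^{-w/2}`, and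
`|ι tr ρ(Frob_v)|² q_v^{-(w+σ)} = |∑ α_P(v)|² q_v^{-σ}` (`normSq_frobTrace_mul_rpow_eq`).

References: J.-P. Serre, *Abelian ℓ-adic representations* (1968), Ch. I §2; C. W. Curtis, I. Reiner,
*Methods of Representation Theory* I (1981), §16B.
-/

noncomputable section

set_option linter.dupNamespace false -- project-wide option (lakefile weak.linter.dupNamespace); `Summit.Langlands.Langlands` is the mandated namespace

open scoped NumberField ComplexConjugate
open Filter IsDedekindDomain Polynomial
open Literature.NumberTheory.Automorphic Literature.NumberTheory.GaloisRepresentations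
open Summit.Langlands.Langlands.Theorems.ReciprocityUpToIrreducibility

namespace Summit.Langlands.Langlands.Theorems.FrobeniusMomentIrreducibilityIrreducibleOfMoments

variable {K : Type} [Field K] [NumberField K] {ℓ : ℕ} [Fact ℓ.Prime]

/-! ### §1 Frobenius characteristic polynomials of framed representations and of blocks -/

/-- At a place where the framed `ρ` is unramified, `ρ.toGaloisRep.frobCharpoly v` is the MATRIX
characteristic polynomial of any arithmetic Frobenius at any `𝔓 ∣ v`
(`GaloisRep.IsUnramifiedAt.frobCharpoly_eq_charpoly`, Mathlib `Matrix.charpoly_toLin'`).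
[cite: SerreAbelianLadic1968, Ch. I §2.1] -/
theorem frobCharpoly_eq_charpoly_of_isArithFrobAt {n : ℕ} (ρ : FramedGaloisRep K (PadicAlgCl ℓ) n)
    {v : HeightOneSpectrum (𝓞 K)} (hv : ρ.IsUnramifiedAt v) :
    ∀ 𝔓 ∈ v.primesAbove, ∀ σ : Field.absoluteGaloisGroup K, IsArithFrobAt (𝓞 K) σ 𝔓 →
      ρ.toGaloisRep.frobCharpoly v = FramedRep.charpoly ρ σ := by
  intro 𝔓 h𝔓 σ hσ
  have hv' : ρ.toGaloisRep.IsUnramifiedAt v :=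
    (FramedGaloisRep.isUnramifiedAt_toGaloisRep_iff v ρ).mpr hv
  rw [GaloisRep.IsUnramifiedAt.frobCharpoly_eq_charpoly hv' h𝔓 hσ]
  have e : (ρ.toGaloisRep σ : (Fin n → PadicAlgCl ℓ) →ₗ[PadicAlgCl ℓ] (Fin n → PadicAlgCl ℓ)) =
      Matrix.toLin' ((ρ σ : GL (Fin n) (PadicAlgCl ℓ)) : Matrix (Fin n) (Fin n) (PadicAlgCl ℓ)) :=
    LinearMap.ext fun x => by simp
  rw [e, Matrix.charpoly_toLin']
  rfl

/-- At an unramified place the Frobenius characteristic polynomial of a framed representation is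
monic (it is a matrix characteristic polynomial, Mathlib `Matrix.charpoly_monic`).
[cite: SerreAbelianLadic1968, Ch. I §2.1] -/
theorem monic_frobCharpoly {n : ℕ} (ρ : FramedGaloisRep K (PadicAlgCl ℓ) n)
    {v : HeightOneSpectrum (𝓞 K)} (hv : ρ.IsUnramifiedAt v) :
    (ρ.toGaloisRep.frobCharpoly v).Monic := by
  obtain ⟨𝔓, h𝔓⟩ := HeightOneSpectrum.primesAbove_nonempty v
  obtain ⟨σ, hσ⟩ := HeightOneSpectrum.exists_isArithFrobAt_of_mem_primesAbove_holds h𝔓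
  rw [frobCharpoly_eq_charpoly_of_isArithFrobAt ρ hv 𝔓 h𝔓 σ hσ]
  exact Matrix.charpoly_monic _

/-- **Dévissage of a reducible pinned-de-Rham framed representation.**  If
`ρ : Γ_K →ₜ* GL_n(ℚ̄_ℓ)`, `n ≥ 1`, is not irreducible, there are framed `ρ₁ : Γ_K →ₜ* GL_m(ℚ̄_ℓ)`,
`ρ₂ : Γ_K →ₜ* GL_p(ℚ̄_ℓ)` with `0 < m`, `0 < p`, unramified wherever `ρ` is, de Rham at every `v ∣ ℓ`
(Fontaine's pinned datum) if `ρ` is, and with `P_{v,ρ} = P_{v,ρ₁} P_{v,ρ₂}` at every unramified `v`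
(the diagonal blocks of `P ρ P⁻¹`: `exists_conj_continuous_blocks_of_subrepresentation`,
`isUnramifiedAt_blocks`, `isDeRhamFramed_blocks` with the proved `stub_deRhamBlocks`,
`charpoly_eq_mul_of_blockTriangular`, `charpoly_conj_eq`).  Curtis–Reiner, *Methods* I, §16B;
Fontaine, Astérisque 223, Exp. III Prop. 1.5.2. [folklore] -/
theorem exists_blocks_of_not_irreducible {n : ℕ} (hn : 0 < n)
    (ρ : FramedGaloisRep K (PadicAlgCl ℓ) n) (hirr : ¬ ρ.toGaloisRep.IsIrreducible)
    (hdR : ∀ (v : HeightOneSpectrum (𝓞 K)) (hv : ((ℓ : ℕ) : 𝓞 K) ∈ v.asIdeal),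
      (Literature.NumberTheory.PAdicHodge.fontainePstAdicCompletion v ℓ hv).IsDeRhamFramed
        (ρ.toLocal v)) :
    ∃ (m p : ℕ), 0 < m ∧ 0 < p ∧ ∃ (ρ₁ : FramedGaloisRep K (PadicAlgCl ℓ) m)
      (ρ₂ : FramedGaloisRep K (PadicAlgCl ℓ) p),
      (∀ v : HeightOneSpectrum (𝓞 K), ρ.IsUnramifiedAt v →
        ρ₁.IsUnramifiedAt v ∧ ρ₂.IsUnramifiedAt v) ∧
      (∀ (v : HeightOneSpectrum (𝓞 K)) (hv : ((ℓ : ℕ) : 𝓞 K) ∈ v.asIdeal),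
        (Literature.NumberTheory.PAdicHodge.fontainePstAdicCompletion v ℓ hv).IsDeRhamFramed
            (ρ₁.toLocal v) ∧
          (Literature.NumberTheory.PAdicHodge.fontainePstAdicCompletion v ℓ hv).IsDeRhamFramed
            (ρ₂.toLocal v)) ∧
      ∀ v : HeightOneSpectrum (𝓞 K), ρ.IsUnramifiedAt v →
        ρ.toGaloisRep.frobCharpoly v = ρ₁.toGaloisRep.frobCharpoly v * ρ₂.toGaloisRep.frobCharpoly v := by
  -- a proper non-zero stable subspace of `ℚ̄_ℓⁿ`
  have hirr' : ¬ IsSimpleOrder (Subrepresentation (FramedRep.toRepresentation ρ)) := hirr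
  have hW : ∃ W : Subrepresentation (FramedRep.toRepresentation ρ), W ≠ ⊥ ∧ W ≠ ⊤ := by
    by_contra hcon
    push Not at hcon
    have hbt : (⊥ : Subrepresentation (FramedRep.toRepresentation ρ)) ≠ ⊤ := by
      intro h
      have h' := congrArg Subrepresentation.toSubmodule h
      change (⊥ : Submodule (PadicAlgCl ℓ) (Fin n → PadicAlgCl ℓ)) = ⊤ at h'
      haveI : Nonempty (Fin n) := ⟨⟨0, hn⟩⟩
      exact bot_ne_top h'
    haveI : Nontrivial (Subrepresentation (FramedRep.toRepresentation ρ)) := ⟨⟨⊥, ⊤, hbt⟩⟩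
    exact hirr' ⟨fun W ↦ or_iff_not_imp_left.mpr (hcon W)⟩
  obtain ⟨W, hW0, hW1⟩ := hW
  -- continuous dévissage with the change of frame recorded
  obtain ⟨m, p, hm0, hp0, -, -, e, P, A, D, hT⟩ :=
    exists_conj_continuous_blocks_of_subrepresentation (k := PadicAlgCl ℓ) ρ W hW0 hW1
  have hur : ∀ v : HeightOneSpectrum (𝓞 K), ρ.IsUnramifiedAt v →
      FramedGaloisRep.IsUnramifiedAt v A ∧ FramedGaloisRep.IsUnramifiedAt v D :=
    fun v hv ↦ isUnramifiedAt_blocks e P ρ A D hT hv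
  refine ⟨m, p, hm0, hp0, A, D, hur,
    fun v hv ↦ isDeRhamFramed_blocks stub_deRhamBlocks e P ρ A D hT v hv (hdR v hv), fun v hv ↦ ?_⟩
  obtain ⟨𝔓, h𝔓⟩ := HeightOneSpectrum.primesAbove_nonempty v
  obtain ⟨σ, hσ⟩ := HeightOneSpectrum.exists_isArithFrobAt_of_mem_primesAbove_holds h𝔓
  rw [frobCharpoly_eq_charpoly_of_isArithFrobAt ρ hv 𝔓 h𝔓 σ hσ,
    frobCharpoly_eq_charpoly_of_isArithFrobAt A (hur v hv).1 𝔓 h𝔓 σ hσ,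
    frobCharpoly_eq_charpoly_of_isArithFrobAt D (hur v hv).2 𝔓 h𝔓 σ hσ, ← charpoly_conj_eq P ρ σ]
  exact charpoly_eq_mul_of_blockTriangular e _ A D hT σ

/-- **Traces add along a dévissage**: if `P_{v,ρ} = P_{v,ρ₁} P_{v,ρ₂}` with all three unramified at
`v` (so the factors are monic), then `tr ρ(Frob_v) = tr ρ₁(Frob_v) + tr ρ₂(Frob_v)`
(`frobTrace = -nextCoeff`, Mathlib `Polynomial.Monic.nextCoeff_mul`). [folklore] -/
theorem frobTrace_eq_add_of_frobCharpoly_eq_mul {n m p : ℕ} {ρ : FramedGaloisRep K (PadicAlgCl ℓ) n}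
    {ρ₁ : FramedGaloisRep K (PadicAlgCl ℓ) m} {ρ₂ : FramedGaloisRep K (PadicAlgCl ℓ) p}
    {v : HeightOneSpectrum (𝓞 K)} (h₁ : ρ₁.IsUnramifiedAt v) (h₂ : ρ₂.IsUnramifiedAt v)
    (h : ρ.toGaloisRep.frobCharpoly v =
      ρ₁.toGaloisRep.frobCharpoly v * ρ₂.toGaloisRep.frobCharpoly v) :
    ρ.toGaloisRep.frobTrace v = ρ₁.toGaloisRep.frobTrace v + ρ₂.toGaloisRep.frobTrace v := by
  simp only [GaloisRep.frobTrace]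
  rw [h, (monic_frobCharpoly ρ₁ h₁).nextCoeff_mul (monic_frobCharpoly ρ₂ h₂), neg_add]

/-- **Roots of a monic factor are roots of the product** (after any ring map to `ℂ`):
used to pass purity of `ρ` to the blocks. [folklore] -/
theorem mem_roots_map_mul_of_mem_roots_map {p q : Polynomial (PadicAlgCl ℓ)} (hp : p.Monic)
    (hq : q.Monic) (f : PadicAlgCl ℓ →+* ℂ) {z : ℂ} :
    (z ∈ (p.map f).roots ∨ z ∈ (q.map f).roots) → z ∈ ((p * q).map f).roots := by
  intro hz
  have h0 : p.map f * q.map f ≠ 0 := ((hp.map f).mul (hq.map f)).ne_zero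
  rw [Polynomial.map_mul, Polynomial.roots_mul h0, Multiset.mem_add]
  exact hz

/-! ### §2 The dictionary at a good place -/

/-- **Roots and trace of the compatible Frobenius polynomial.**  If the framed `ρ` has Frobenius
characteristic polynomial `arithFrobPolyOfSatake ι q_v 1 α' = ∏_{a ∈ α'} (X - ι⁻¹(a⁻¹))` at `v`
(and is unramified there), then `ι P_{v,ρ}` has roots `α'⁻¹` and `ι tr ρ(Frob_v) = ∑_{a ∈ α'} a⁻¹`
(`arithFrobPolyOfSatake_one`, Mathlib `roots_multiset_prod_X_sub_C`, `multiset_prod_X_sub_C_nextCoeff`).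
[cite: SerreAbelianLadic1968, Ch. I §2.3] -/
theorem roots_and_trace_of_hasFrobCharpolyAt {n : ℕ} (ι : PadicAlgCl ℓ ≃+* ℂ)
    (ρ : FramedGaloisRep K (PadicAlgCl ℓ) n) {v : HeightOneSpectrum (𝓞 K)}
    (hur : ρ.IsUnramifiedAt v) {α' : Multiset ℂ}
    (hP : ρ.HasFrobCharpolyAt v (arithFrobPolyOfSatake ι v.residueCard 1 α')) :
    ((ρ.toGaloisRep.frobCharpoly v).map (ι : PadicAlgCl ℓ ≃+* ℂ).toRingHom).roots = α'.map (·⁻¹) ∧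
      (ι : PadicAlgCl ℓ ≃+* ℂ) (ρ.toGaloisRep.frobTrace v) = (α'.map (·⁻¹)).sum := by
  have hur' : ρ.toGaloisRep.IsUnramifiedAt v :=
    (FramedGaloisRep.isUnramifiedAt_toGaloisRep_iff v ρ).mpr hur
  have hP' : ρ.toGaloisRep.HasFrobCharpolyAt v (arithFrobPolyOfSatake ι v.residueCard 1 α') :=
    (FramedGaloisRep.hasFrobCharpolyAt_toGaloisRep_iff v _ ρ).mpr hP
  have hfc : ρ.toGaloisRep.frobCharpoly v =
      ((α'.map fun a => ι.symm a⁻¹).map fun x => X - C x).prod := by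
    rw [hur'.frobCharpoly_eq_of_hasFrobCharpolyAt hP', arithFrobPolyOfSatake_one, Multiset.map_map]
    rfl
  have hιmap : (α'.map fun a => ι.symm a⁻¹).map (ι : PadicAlgCl ℓ ≃+* ℂ) = α'.map (·⁻¹) := by
    rw [Multiset.map_map]
    refine Multiset.map_congr rfl fun a _ => ?_
    simp only [Function.comp_apply, RingEquiv.apply_symm_apply]
  refine ⟨?_, ?_⟩
  · rw [hfc, Polynomial.map_multiset_prod, Multiset.map_map]
    have hfun : (Polynomial.map (ι : PadicAlgCl ℓ ≃+* ℂ).toRingHom ∘ fun x : PadicAlgCl ℓ => X - C x) =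
        (fun x : ℂ => X - C x) ∘ (ι : PadicAlgCl ℓ ≃+* ℂ) := by
      funext x
      simp only [Function.comp_apply, Polynomial.map_sub, Polynomial.map_X, Polynomial.map_C,
        RingEquiv.toRingHom_eq_coe, RingHom.coe_coe]
    rw [hfun, ← Multiset.map_map, Polynomial.roots_multiset_prod_X_sub_C, hιmap]
  · rw [GaloisRep.frobTrace, hfc, Polynomial.multiset_prod_X_sub_C_nextCoeff, neg_neg,
      ← Multiset.sum_hom _ (ι : PadicAlgCl ℓ ≃+* ℂ)]
    · rw [hιmap]

/-- **Unit absolute values from purity and a unitary central character.**  If `card α = n ≥ 1`,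
`|∏ α| = 1` and every element of `q^{s} α` has inverse of absolute value `r > 0`, then every element of
`α` has absolute value `1` and `|q^{s}| r = 1` (all `|b|`, `b ∈ α`, equal the same constant, whose
`n`-th power is `1`). [folklore] -/
theorem norm_eq_one_of_pure {α : Multiset ℂ} {n : ℕ} (hn : 0 < n) (hcard : Multiset.card α = n)
    (hprod : ‖α.prod‖ = 1) {c : ℂ} {r : ℝ} (hr : 0 < r)
    (hpure : ∀ b ∈ α, ‖(c * b)⁻¹‖ = r) :
    (∀ b ∈ α, ‖b‖ = 1) ∧ ‖c‖ * r = 1 := by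
  have hc0 : c ≠ 0 := by
    obtain ⟨b, hb⟩ := Multiset.card_pos_iff_exists_mem.mp (by omega : 0 < Multiset.card α)
    intro h
    have := hpure b hb
    rw [h, zero_mul, inv_zero, norm_zero] at this
    exact hr.ne' this.symm
  have hκ : ∀ b ∈ α, ‖b‖ = (‖c‖ * r)⁻¹ := by
    intro b hb
    have h := hpure b hb
    have hb0 : b ≠ 0 := by
      intro h0
      rw [h0, mul_zero, inv_zero, norm_zero] at h
      exact hr.ne' h.symm
    rw [norm_inv, norm_mul] at h
    have hcb : ‖c‖ * ‖b‖ ≠ 0 := mul_ne_zero (norm_ne_zero_iff.mpr hc0) (norm_ne_zero_iff.mpr hb0)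
    field_simp
    have := h
    field_simp at this
    linarith [this]
  have hpow : ((‖c‖ * r)⁻¹) ^ n = 1 := by
    have h1 : (α.map fun b => ‖b‖).prod = ‖α.prod‖ :=
      Multiset.induction_on α (by simp) fun a s ih => by
        simp only [Multiset.map_cons, Multiset.prod_cons, norm_mul, ih]
    have h2 : (α.map fun b => ‖b‖) = Multiset.replicate n ((‖c‖ * r)⁻¹) := by
      rw [Multiset.eq_replicate, Multiset.card_map, hcard]
      refine ⟨rfl, fun x hx => ?_⟩
      obtain ⟨b, hb, rfl⟩ := Multiset.mem_map.mp hx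
      exact hκ b hb
    rw [← Multiset.prod_replicate, ← h2, h1, hprod]
  have hκ1 : (‖c‖ * r)⁻¹ = 1 := by
    have hnn : 0 ≤ (‖c‖ * r)⁻¹ := inv_nonneg.mpr (mul_nonneg (norm_nonneg _) hr.le)
    exact (pow_eq_one_iff_of_nonneg hnn hn.ne').mp hpow
  refine ⟨fun b hb => (hκ b hb).trans hκ1, ?_⟩
  exact inv_eq_one.mp hκ1

/-- **The dictionary at a good place** (Borel–Jacquet 5.7 + purity + unitary central character):
if `ρ` is unramified at `v` with `P_{v,ρ} = ∏_{a ∈ α'} (X - ι⁻¹(a⁻¹))`, `α' = q_v^{s} α_P(v)`,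
`card α_P(v) = n ≥ 1`, `|∏ α_P(v)| = 1`, and every root of `ι P_{v,ρ}` has absolute value
`q_v^{w/2}`, then for every real `σ`,
`|ι tr ρ(Frob_v)|² q_v^{-(w+σ)} = |∑ α_P(v)|² q_v^{-σ}`.
[cite: BorelJacquet1979, 5.7] [cite: SerreAbelianLadic1968, Ch. I §2.3] -/
theorem normSq_frobTrace_mul_rpow_eq {n : ℕ} (hn : 0 < n) (ι : PadicAlgCl ℓ ≃+* ℂ)
    (ρ : FramedGaloisRep K (PadicAlgCl ℓ) n) {v : HeightOneSpectrum (𝓞 K)}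
    (hur : ρ.IsUnramifiedAt v) {α' αP : Multiset ℂ} {s : ℂ}
    (hP : ρ.HasFrobCharpolyAt v (arithFrobPolyOfSatake ι v.residueCard 1 α'))
    (hα' : α' = αP.map (((v.residueCard : ℂ) ^ s) * ·)) (hcard : Multiset.card αP = n)
    (hprod : ‖αP.prod‖ = 1) {w : ℝ}
    (hpure : ∀ z ∈ ((ρ.toGaloisRep.frobCharpoly v).map (ι : PadicAlgCl ℓ ≃+* ℂ).toRingHom).roots,
      ‖z‖ = (v.residueCard : ℝ) ^ (w / 2)) (σ : ℝ) :
    ‖(ι : PadicAlgCl ℓ ≃+* ℂ) (ρ.toGaloisRep.frobTrace v)‖ ^ 2 *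
        (v.residueCard : ℝ) ^ (-(w + σ)) =
      ‖αP.sum‖ ^ 2 * (v.residueCard : ℝ) ^ (-σ) := by
  obtain ⟨hroots, htr⟩ := roots_and_trace_of_hasFrobCharpolyAt ι ρ hur hP
  have hq0 : (0 : ℝ) < v.residueCard := by exact_mod_cast zero_lt_one.trans v.one_lt_residueCard
  set r : ℝ := (v.residueCard : ℝ) ^ (w / 2) with hr
  have hr0 : 0 < r := Real.rpow_pos_of_pos hq0 _
  -- purity, read on `α_P(v)`
  have hpure' : ∀ b ∈ αP, ‖(((v.residueCard : ℂ) ^ s) * b)⁻¹‖ = r := by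
    intro b hb
    apply hpure
    rw [hroots, hα', Multiset.map_map]
    exact Multiset.mem_map.mpr ⟨b, hb, rfl⟩
  obtain ⟨hone, hcs⟩ := norm_eq_one_of_pure hn hcard hprod hr0 hpure'
  -- the trace
  have htr' : (ι : PadicAlgCl ℓ ≃+* ℂ) (ρ.toGaloisRep.frobTrace v) =
      ((v.residueCard : ℂ) ^ s)⁻¹ * conj αP.sum := by
    rw [htr, hα', Multiset.map_map]
    have h1 : ((fun x : ℂ => x⁻¹) ∘ fun b : ℂ => (v.residueCard : ℂ) ^ s * b) =
        fun b => ((v.residueCard : ℂ) ^ s)⁻¹ * b⁻¹ := by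
      funext b
      simp only [Function.comp_apply, mul_inv]
    rw [h1, Multiset.sum_map_mul_left]
    congr 1
    rw [← Multiset.sum_hom αP (starRingEnd ℂ)]
    · refine congrArg _ (Multiset.map_congr rfl fun b hb => ?_)
      exact Complex.inv_eq_conj (hone b hb)
  have hnorm : ‖(ι : PadicAlgCl ℓ ≃+* ℂ) (ρ.toGaloisRep.frobTrace v)‖ = r * ‖αP.sum‖ := by
    rw [htr', norm_mul, norm_inv, Complex.norm_conj]
    congr 1
    rw [inv_eq_iff_eq_inv]
    exact (eq_inv_of_mul_eq_one_left hcs)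
  -- exponents
  have hexp : (v.residueCard : ℝ) ^ (-(w + σ)) = (r ^ 2)⁻¹ * (v.residueCard : ℝ) ^ (-σ) := by
    rw [hr, ← Real.rpow_natCast, ← Real.rpow_mul hq0.le, ← Real.rpow_neg hq0.le,
      ← Real.rpow_add hq0]
    congr 1
    push_cast
    ring
  rw [hnorm, hexp, mul_pow]
  have hr2 : r ^ 2 ≠ 0 := pow_ne_zero 2 hr0.ne'
  field_simp

end Summit.Langlands.Langlands.Theorems.FrobeniusMomentIrreducibilityIrreducibleOfMoments

end
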